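import Mathlib.RingTheory.MvPolynomial.EulerIdentity
import Summits.Schanuel.Schanuel.Theorems.ZilberEacComplexHypersurfaceEscape
import HarnessLib

/-!
# Linear escape over hypersurface bases: sign symmetry and complex hyperplanes

Corollaries of Theorem H_esc (`ZilberEacComplexHypersurfaceEscape.lean`; Exponential-Algebraic Closedness
over an arbitrary hypersurface base `{H = 0}` for Laurent-parametrised escape fibres
`yᵢ = cᵢ t^{νᵢ} + Σ_{m<νᵢ} A_{i,m}(x) tᵐ`; first open rung `dim π₁(V) = n - 1`, Mantova–Masser, PLMS 129
(2024), §1 p. 5):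

* `exists_expPoint_hypersurfaceEscape_of_re_ne_zero` — the lattice root `λ` may have `Re λ ≠ 0` of
  either sign (`q ↦ -q`, `λ ↦ -λ`: `H_D(-λν - 2πiq) = (-1)ᴰ H_D(λν + 2πiq)`). So the hypothesis of
  Theorem H_esc fails only if for EVERY `q ∈ ℤⁿ` all simple roots of `λ ↦ H_D(λν + 2πiq)` are purely
  imaginary — for a real leading form with `H_D(ν) ≠ 0` this says (by density of `ℚⁿ` and scaling) that
  `H_D` is GÅRDING-HYPERBOLIC in the direction `ν`; e.g. every real linear form is, which is why real
  hyperplanes needed the second-order Theorem R of this packet (analysis in RUNG-CENSUS; not typed);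
* `exists_expPoint_hyperplaneEscape` — **every complex hyperplane `b·x = c₀` whose normal vector is
  not a complex multiple of a real vector** (precisely: `b·ν ≠ 0` and `Im(bⱼ/(b·ν)) ≠ 0` for some `j`)
  carries exponential points of every escape family with `b·ν ≠ 0` — no further hypothesis.

HONEST FRAMING: modest sub-rungs of EAC; nothing here bears on Schanuel's conjecture; EC(3,2) open.
-/

noncomputable section

open Complex MvPolynomial Metric Set Filter Topology

set_option linter.dupNamespace false

namespace Summit.Schanuel.Schanuel.Theorems

/-- **Sign symmetry of the lattice root.** Theorem H_esc with `Re λ ≠ 0` instead of `Re λ > 0`: if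
`Re λ < 0`, replace `(q, λ)` by `(-q, -λ)` — then `v ↦ -v`, `H_D(-v) = (-1)ᴰ H_D(v) = 0` and
`Σ νᵢ ∂ᵢH_D(-v) = (-1)^{D-1} Σ νᵢ ∂ᵢH_D(v) ≠ 0` by homogeneity.
[cite: MantovaMasser2023, §1 p.5 (the open case dim π(V) = 2 in ℂ³×ℂˣ³)] -/
theorem exists_expPoint_hypersurfaceEscape_of_re_ne_zero {n : ℕ} (H : MvPolynomial (Fin n) ℂ)
    (hD : 1 ≤ H.totalDegree) (ν q : Fin n → ℤ) (lam : ℂ) (hre : lam.re ≠ 0)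
    (hroot : eval (fun i => lam * (ν i : ℂ) + 2 * Real.pi * I * (q i : ℂ))
      (homogeneousComponent H.totalDegree H) = 0)
    (hβ : ∑ i, (ν i : ℂ) * eval (fun i => lam * (ν i : ℂ) + 2 * Real.pi * I * (q i : ℂ))
      (pderiv i (homogeneousComponent H.totalDegree H)) ≠ 0)
    (c : Fin n → ℂ) (hc : ∀ i, c i ≠ 0) (S : Fin n → Finset ℤ) (hS : ∀ i, ∀ m ∈ S i, m < ν i)
    (A : Fin n → ℤ → MvPolynomial (Fin n) ℂ) :
    ∃ x : Fin n → ℂ, ∃ L : ℂ, eval x H = 0 ∧ ∀ i,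
      exp (x i) = c i * exp ((ν i : ℂ) * L) + ∑ m ∈ S i, eval x (A i m) * exp ((m : ℂ) * L) := by
  rcases hre.lt_or_gt with hneg | hpos
  · -- flip the sign of `(q, λ)`
    have hhom : (homogeneousComponent H.totalDegree H).IsHomogeneous H.totalDegree :=
      homogeneousComponent_isHomogeneous _ H
    have hv' : (fun i => -lam * (ν i : ℂ) + 2 * Real.pi * I * ((-q i : ℤ) : ℂ)) =
        (-1 : ℂ) • (fun i => lam * (ν i : ℂ) + 2 * Real.pi * I * (q i : ℂ)) := by
      funext i; simp only [Pi.smul_apply, smul_eq_mul]; push_cast; ring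
    refine exists_expPoint_hypersurfaceEscape H hD ν (fun i => -q i) (-lam)
      (by rw [Complex.neg_re]; linarith) ?_ ?_ c hc S hS A
    · rw [hv', hhom.eval_smul_eq, hroot, mul_zero]
    · rw [hv']
      have key : ∀ i, eval ((-1 : ℂ) • fun i => lam * (ν i : ℂ) + 2 * Real.pi * I * (q i : ℂ))
          (pderiv i (homogeneousComponent H.totalDegree H)) =
          (-1 : ℂ) ^ (H.totalDegree - 1) *
            eval (fun i => lam * (ν i : ℂ) + 2 * Real.pi * I * (q i : ℂ))
              (pderiv i (homogeneousComponent H.totalDegree H)) :=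
        fun i => hhom.pderiv.eval_smul_eq _ _
      simp_rw [key]
      have hsum : ∑ i, (ν i : ℂ) * ((-1 : ℂ) ^ (H.totalDegree - 1) *
          eval (fun i => lam * (ν i : ℂ) + 2 * Real.pi * I * (q i : ℂ))
            (pderiv i (homogeneousComponent H.totalDegree H))) =
          (-1 : ℂ) ^ (H.totalDegree - 1) * ∑ i, (ν i : ℂ) *
            eval (fun i => lam * (ν i : ℂ) + 2 * Real.pi * I * (q i : ℂ))
              (pderiv i (homogeneousComponent H.totalDegree H)) := by
        rw [Finset.mul_sum]; exact Finset.sum_congr rfl fun i _ => by ring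
      rw [hsum]
      exact mul_ne_zero (pow_ne_zero _ (by norm_num)) hβ
  · exact exists_expPoint_hypersurfaceEscape H hD ν q lam hpos hroot hβ c hc S hS A

/-- **EC by escape over complex hyperplanes.** Let `b ∈ ℂⁿ`, `c₀ ∈ ℂ`, `ν ∈ ℤⁿ` with `b·ν ≠ 0`, and
suppose `Im(bⱼ/(b·ν)) ≠ 0` for some `j` (i.e. `b` is NOT a complex multiple of a real vector). Then for
all `cᵢ ≠ 0`, finite `Sᵢ ⊆ ℤ` below `νᵢ` and arbitrary `A_{i,m} ∈ ℂ[x]` there are `x` on the hyperplane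
`Σ bᵢxᵢ = c₀` and `L` with `e^{xᵢ} = cᵢ e^{νᵢL} + Σ_{m ∈ Sᵢ} A_{i,m}(x) e^{mL}`: the `n`-fold swept by the
escape fibres over the hyperplane (`dim π₁ V = n - 1`, first open range of Exponential-Algebraic
Closedness, Mantova–Masser 2024 §1 p. 5) meets the graph of `exp`. (Theorem H_esc with `D = 1`,
`q = ±eⱼ`, `λ = ∓2πi bⱼ/(b·ν)`, `Re λ = ±2π Im(bⱼ/(b·ν))`.) Real hyperplanes — the complementary case —
are the oscillatory Theorem R of this packet. New.
[cite: MantovaMasser2023, §1 p.5 (the open case dim π(V) = 2 in ℂ³×ℂˣ³)] -/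
theorem exists_expPoint_hyperplaneEscape {n : ℕ} (b : Fin n → ℂ) (c₀ : ℂ) (ν : Fin n → ℤ)
    (hbν : ∑ i, b i * (ν i : ℂ) ≠ 0) (j : Fin n) (hj : (b j / ∑ i, b i * (ν i : ℂ)).im ≠ 0)
    (c : Fin n → ℂ) (hc : ∀ i, c i ≠ 0) (S : Fin n → Finset ℤ) (hS : ∀ i, ∀ m ∈ S i, m < ν i)
    (A : Fin n → ℤ → MvPolynomial (Fin n) ℂ) :
    ∃ x : Fin n → ℂ, ∃ L : ℂ, ∑ i, b i * x i = c₀ ∧ ∀ i,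
      exp (x i) = c i * exp ((ν i : ℂ) * L) + ∑ m ∈ S i, eval x (A i m) * exp ((m : ℂ) * L) := by
  classical
  set β : ℂ := ∑ i, b i * (ν i : ℂ) with hβdef
  set Lf : MvPolynomial (Fin n) ℂ := ∑ i, C (b i) * X i with hLf
  set H : MvPolynomial (Fin n) ℂ := Lf + C (-c₀) with hH
  have hLhom : Lf.IsHomogeneous 1 := by
    rw [hLf]
    refine IsHomogeneous.sum _ _ _ fun i _ => ?_
    simpa using (isHomogeneous_C (Fin n) (b i)).mul (isHomogeneous_X ℂ i)
  have hevalL : ∀ x : Fin n → ℂ, eval x Lf = ∑ i, b i * x i := fun x => by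
    simp [hLf, map_sum, map_mul, eval_C, eval_X]
  have hevalH : ∀ x : Fin n → ℂ, eval x H = ∑ i, b i * x i - c₀ := fun x => by
    rw [hH, map_add, hevalL, eval_C]; ring
  have hL0 : Lf ≠ 0 := by
    intro h
    have := hevalL fun i => (ν i : ℂ)
    rw [h, map_zero] at this
    exact hbν this.symm
  have hLdeg : Lf.totalDegree = 1 := hLhom.totalDegree hL0
  have hHdeg : H.totalDegree = 1 := by
    rw [hH, totalDegree_add_eq_left_of_totalDegree_lt, hLdeg]
    rw [totalDegree_C, hLdeg]; norm_num
  have hHD : homogeneousComponent H.totalDegree H = Lf := by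
    rw [hHdeg, hH, map_add, homogeneousComponent_eq_self hLhom,
      homogeneousComponent_of_mem (isHomogeneous_C (Fin n) (-c₀ : ℂ))]
    simp
  have hpd : ∀ i x, eval x (pderiv i Lf) = b i := by
    intro i x
    have : pderiv i Lf = C (b i) := by
      rw [hLf, map_sum]
      simp only [Derivation.leibniz, pderiv_C, pderiv_X, smul_eq_mul]
      rw [Finset.sum_eq_single i]
      · simp
      · intro k _ hk; simp [Pi.single_eq_of_ne hk]
      · intro h; exact absurd (Finset.mem_univ i) h
    rw [this, eval_C]
  -- the sign `σ` and the root `λ = -2πiσ bⱼ/β`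
  set w : ℂ := b j / β with hw
  obtain ⟨σ, hσ, hσpos⟩ : ∃ σ : ℝ, (σ = 1 ∨ σ = -1) ∧ 0 < σ * w.im := by
    rcases hj.lt_or_gt with h | h
    · exact ⟨-1, Or.inr rfl, by nlinarith⟩
    · exact ⟨1, Or.inl rfl, by nlinarith⟩
  have hσZ : ∃ s : ℤ, (s : ℝ) = σ := by
    rcases hσ with h | h
    · exact ⟨1, by simp [h]⟩
    · exact ⟨-1, by simp [h]⟩
  obtain ⟨s, hs⟩ := hσZ
  set lam : ℂ := -(2 * Real.pi * I * σ * w) with hlam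
  have hre : 0 < lam.re := by
    have : lam.re = 2 * Real.pi * (σ * w.im) := by
      simp [hlam, Complex.mul_re, Complex.mul_im]; ring
    rw [this]; positivity
  set q : Fin n → ℤ := fun i => if i = j then s else 0 with hq
  have hqC : ∀ i, (q i : ℂ) = if i = j then (σ : ℂ) else 0 := by
    intro i; simp only [hq]; split_ifs <;> simp [← hs]
  have hroot : eval (fun i => lam * (ν i : ℂ) + 2 * Real.pi * I * (q i : ℂ))
      (homogeneousComponent H.totalDegree H) = 0 := by
    rw [hHD, hevalL]
    simp only [hqC, mul_add, mul_ite, mul_zero, Finset.sum_add_distrib, Finset.sum_ite_eq',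
      Finset.mem_univ, if_true]
    have h1 : ∑ i, b i * (lam * (ν i : ℂ)) = lam * β := by
      rw [hβdef, Finset.mul_sum]; refine Finset.sum_congr rfl fun i _ => ?_; ring
    rw [h1, hlam, hw]
    field_simp
    ring
  have hβ' : ∑ i, (ν i : ℂ) * eval (fun i => lam * (ν i : ℂ) + 2 * Real.pi * I * (q i : ℂ))
      (pderiv i (homogeneousComponent H.totalDegree H)) ≠ 0 := by
    rw [hHD]
    simp only [hpd]
    have : ∑ i, (ν i : ℂ) * b i = β := by
      rw [hβdef]; refine Finset.sum_congr rfl fun i _ => ?_; ring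
    rw [this]; exact hbν
  obtain ⟨x, L, hxH, hx⟩ := exists_expPoint_hypersurfaceEscape H (by rw [hHdeg]) ν q lam hre hroot
    hβ' c hc S hS A
  refine ⟨x, L, ?_, hx⟩
  have := hevalH x
  rw [hxH] at this
  linear_combination -this

end Summit.Schanuel.Schanuel.Theorems
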